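import Mathlib.MeasureTheory.Measure.Haar.Unique
import Mathlib.Topology.Algebra.ContinuousMonoidHom
import HarnessLib

/-!
# An automorphism of a locally compact group whose square is inner preserves Haar measure
(Weil, *L'intégration dans les groupes topologiques* §9 «module d'un automorphisme»; Bourbaki, *Intégration* VII §1 no. 4; Folland (1995), Thm. 2.20)

Topic `MeasureTheory/Group`; namespace `Literature.MeasureTheory.Group`.  THEOREMS ONLY (no definition, no instance, no notation, no named
fact, no `sorry`).  Cell `pub/hodgecm-mathlib`, ROAD «UP-TR» (holder F0P3-p02 (g23)), the generic engine lemma behind (P2) of the census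
`F0/P3a/F0P3a-p09/g11/uptr/CENSUS-H6-StOrbH-partner.v1.F0P3ap09g11.md` («the stable partner automorphism `e = (Ad diag(1,r), id)` of
`H_v = U(Φ₂) × U(Φ₁)` preserves `νHv`»).  HONEST LABEL: count-neutral kit; HC_CM is proved only modulo the printed citations until rung 0 closes.

THE MATHEMATICS.  The MODULE of a bicontinuous automorphism `e` of a locally compact group `G` with left Haar measure `μ` is the constant
`c > 0` with `e_* μ = c • μ` (uniqueness of Haar measure).  It is multiplicative in `e`; an INNER automorphism `g ↦ u g u⁻¹` has module `1` as
soon as `μ` is also right invariant (unimodular `G`); hence an automorphism some power of which is inner (here: the square) has module `1`,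
i.e. is measure preserving ON THE NOSE.
* §1 `map_continuousMulEquiv_eq_self_of_map_map_eq_self` ∕ **`measurePreserving_of_map_map_eq_self`** — if `e_* e_* μ = μ` then `e_* μ = μ`.
* §2 **`measurePreserving_of_forall_apply_apply_eq_conj`** — if `e (e g) = u * g * u⁻¹` for all `g` then `MeasurePreserving e μ μ` (the inner
  square is measure preserving: `conj(u) = (· u⁻¹) ∘ (u ·)`, Mathlib `map_mul_left_eq_self` ∕ `map_mul_right_eq_self`; cf. ★ `Literature.MeasureTheory.Group.map_conj_eq_self`); `integral_comp_eq_of_forall_apply_apply_eq_conj` —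
  `∫ f (e g) ∂μ = ∫ f ∂μ`, and the `lintegral` ∕ `Integrable` forms.

## References
* [WeilIntegration1965] A. Weil, *L'intégration dans les groupes topologiques et ses applications*, 2e éd., Hermann (1965), §9.
* [BourbakiINT7] N. Bourbaki, *Intégration*, Ch. VII §1 no. 4 (module d'un automorphisme).
* [Folland1995] G. B. Folland, *A Course in Abstract Harmonic Analysis*, CRC Press (1995), Thm. 2.20, Prop. 2.24.
-/

set_option autoImplicit false

noncomputable section

open MeasureTheory Measure Set
open scoped ENNReal NNReal

namespace Literature.MeasureTheory.Group


section Auto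

variable {G : Type*} [Group G] [TopologicalSpace G] [IsTopologicalGroup G] [LocallyCompactSpace G] [SecondCountableTopology G]
  [MeasurableSpace G] [BorelSpace G] (e : G ≃ₜ* G) (μ : Measure G) [μ.IsHaarMeasure]

/-- **An automorphism whose square preserves Haar measure preserves Haar measure**: if `e_* (e_* μ) = μ` then `e_* μ = μ`.  Indeed
`e_* μ = c • μ` with `0 < c` (uniqueness of Haar measure), so `e_* e_* μ = c² • μ`, and `c² = 1` forces `c = 1` (evaluate on a compact
neighbourhood of `1`, of positive finite measure). [cite: Folland1995, Thm. 2.20] [cite: BourbakiINT7, Ch. VII §1 no. 4] -/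
theorem map_continuousMulEquiv_eq_self_of_map_map_eq_self (h : (μ.map e).map e = μ) : μ.map e = μ := by
  haveI : (μ.map e).IsHaarMeasure := e.isHaarMeasure_map μ
  set c : ℝ≥0 := haarScalarFactor (μ.map e) μ with hc
  have h1 : μ.map e = c • μ := isMulLeftInvariant_eq_smul _ _
  have h2 : (μ.map e).map e = (c * c) • μ := by
    conv_lhs => rw [h1, Measure.map_smul, h1, smul_smul]
  -- evaluate on a compact set with non-empty interior
  obtain ⟨K, hK, h1K⟩ := exists_compact_mem_nhds (1 : G)
  have hK0 : μ K ≠ 0 := (measure_pos_of_mem_nhds μ h1K).ne'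
  have hKtop : μ K ≠ ∞ := hK.measure_lt_top.ne
  have h3 : ((c * c : ℝ≥0) : ℝ≥0∞) * μ K = 1 * μ K := by
    have := congrArg (fun ν : Measure G => ν K) h2
    simp only [Measure.smul_apply, h, ENNReal.smul_def, smul_eq_mul] at this
    rw [one_mul]
    exact this.symm
  have h4 : c * c = 1 := by
    have := (ENNReal.mul_left_inj hK0 hKtop).1 h3
    exact_mod_cast this
  have h5 : c = 1 := by
    have h4' : (c : ℝ) * c = 1 := by exact_mod_cast h4
    have h6 : ((c : ℝ) - 1) * ((c : ℝ) + 1) = 0 := by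
      rw [show ((c : ℝ) - 1) * ((c : ℝ) + 1) = (c : ℝ) * c - 1 by ring, h4', sub_self]
    have hpos : (0 : ℝ) < c + 1 := by positivity
    have h7 := (mul_eq_zero.1 h6).resolve_right hpos.ne'
    exact_mod_cast (sub_eq_zero.1 h7)
  rw [h1, h5, one_smul]

/-- **`MeasurePreserving` form**: if `e_* (e_* μ) = μ` then `e` is measure preserving for `μ`. [cite: Folland1995, Thm. 2.20] -/
theorem measurePreserving_of_map_map_eq_self (h : (μ.map e).map e = μ) : MeasurePreserving e μ μ :=
  ⟨e.continuous.measurable, map_continuousMulEquiv_eq_self_of_map_map_eq_self e μ h⟩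

/-- **An automorphism with INNER SQUARE preserves Haar measure** (two-sided invariant `μ`): if `e (e g) = u g u⁻¹` for all `g`, then
`MeasurePreserving e μ μ` — the module of `e` is a positive square root of the module of `Ad u`, which is `1`.
[cite: WeilIntegration1965, §9] [cite: BourbakiINT7, Ch. VII §1 no. 4] [cite: Folland1995, Thm. 2.20, Prop. 2.24] -/
theorem measurePreserving_of_forall_apply_apply_eq_conj [μ.IsMulRightInvariant] {u : G} (h : ∀ g, e (e g) = u * g * u⁻¹) :
    MeasurePreserving e μ μ := by
  refine measurePreserving_of_map_map_eq_self e μ ?_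
  have hme : Measurable (e : G → G) := e.continuous.measurable
  rw [Measure.map_map hme hme, show ((e : G → G) ∘ (e : G → G)) = (fun x : G => x * u⁻¹) ∘ (fun x : G => u * x) from funext fun g => h g,
    ← Measure.map_map (measurable_mul_const u⁻¹) (measurable_const_mul u), map_mul_left_eq_self, map_mul_right_eq_self]

/-- `e_* μ = μ` when `e ∘ e` is inner. [cite: WeilIntegration1965, §9] [cite: Folland1995, Thm. 2.20] -/
theorem map_eq_self_of_forall_apply_apply_eq_conj [μ.IsMulRightInvariant] {u : G} (h : ∀ g, e (e g) = u * g * u⁻¹) : μ.map e = μ :=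
  (measurePreserving_of_forall_apply_apply_eq_conj e μ h).map_eq

/-- **Change of variables**: `∫ f (e g) ∂μ = ∫ f ∂μ` for every `f` (Banach-valued, no integrability needed) when `e ∘ e` is inner.
[cite: WeilIntegration1965, §9] [cite: Folland1995, Thm. 2.20] -/
theorem integral_comp_eq_of_forall_apply_apply_eq_conj [μ.IsMulRightInvariant] {u : G} (h : ∀ g, e (e g) = u * g * u⁻¹)
    {E : Type*} [NormedAddCommGroup E] [NormedSpace ℝ E] (f : G → E) : ∫ g, f (e g) ∂μ = ∫ g, f g ∂μ := by
  have hmp := measurePreserving_of_forall_apply_apply_eq_conj e μ h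
  exact hmp.integral_comp e.toHomeomorph.toMeasurableEquiv.measurableEmbedding f

/-- `∫⁻ f (e g) ∂μ = ∫⁻ f ∂μ` for every `f : G → ℝ≥0∞` when `e ∘ e` is inner. [cite: WeilIntegration1965, §9] [cite: Folland1995, Thm. 2.20] -/
theorem lintegral_comp_eq_of_forall_apply_apply_eq_conj [μ.IsMulRightInvariant] {u : G} (h : ∀ g, e (e g) = u * g * u⁻¹)
    (f : G → ℝ≥0∞) : ∫⁻ g, f (e g) ∂μ = ∫⁻ g, f g ∂μ := by
  have hmp := measurePreserving_of_forall_apply_apply_eq_conj e μ h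
  exact hmp.lintegral_comp_emb e.toHomeomorph.toMeasurableEquiv.measurableEmbedding f

/-- **Integrability transports**: `Integrable (f ∘ e) μ ↔ Integrable f μ` when `e ∘ e` is inner. [cite: Folland1995, Thm. 2.20] -/
theorem integrable_comp_iff_of_forall_apply_apply_eq_conj [μ.IsMulRightInvariant] {u : G} (h : ∀ g, e (e g) = u * g * u⁻¹)
    {E : Type*} [NormedAddCommGroup E] (f : G → E) : Integrable (f ∘ e) μ ↔ Integrable f μ := by
  have hmp := measurePreserving_of_forall_apply_apply_eq_conj e μ h
  exact hmp.integrable_comp_emb e.toHomeomorph.toMeasurableEquiv.measurableEmbedding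

end Auto

end Literature.MeasureTheory.Group

end
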